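import Summits.Schanuel.Schanuel.Theorems.ZilberEacConicRationalNorm
import Summits.Schanuel.Schanuel.Theorems.ZilberEacHyperellipticSheetCase
import HarnessLib

/-!
# Arbitrary base branches, LVIII (b): RATIONAL fibres over the CONICS — every nonzero rational
# function on `x₁² = P(x₀)`, `deg P = 2`

HONEST FRAMING.  Cell `pub-schanuel` (Zilber's Exponential-Algebraic Closedness, case ladder;
host summit Schanuel), seat 2, gen 30.  File L decided every POLYNOMIAL fibre over a conic by the
sheet norm; here the norm is taken of the homogenised substitution
`E(x, z, Y) = Σ_j h_j(x)(A + zB)^j(A' + zB')^{d−j}Y^j` (`d = deg_Y H`), so that a relation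
`H(x₀, f·θ'e^{η}) = 0` for the RATIONAL fibre value `f = (A + x₁B)/(A' + x₁B')` again yields
`Hn(x₀, θ'e^{η}) = 0` with `Hn ≠ 0` (**`exists_sheetNorm₃`**, **`sheetNorm₃_ne_zero`**), contradicting
file XLIII.  Result: **`unprojectedDense_conic_rationalFibre`** — for `P` monic quadratic with simple
roots and `(A, B), (A', B') ≠ (0, 0)`, every irreducible surface `S` of dimension `≤ 2` containing the
graph of `(A + x₁B)/(A' + x₁B')` over the conic (off the poles) has Zariski-dense exponential points;
**`unprojectedDense_conic_rationalFibreMv`** — the same for `R/Q` with `R, Q ∈ ℂ[x₀, x₁]` nonzero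
somewhere on the conic.  With files LVI–LVII: the graph of EVERY nonzero rational function over every
cyclic cover `x₁^k = P(x₀)` is covered except `k = 2`, `deg P ≡ 2 (mod 4)`, `deg P ≥ 6` (O86).
Decided instances of an OPEN question (Mantova–Masser, PLMS 2024 §1 p. 5); EC(3,2) OPEN; NOT
Schanuel's conjecture (neither used nor implied); EAC ⇏ SC.
-/

noncomputable section

open Filter Topology Set Complex Polynomial
open Literature.NumberTheory.Transcendental Literature.ModelTheory.Zilber
open Literature.ModelTheory.ExponentialFields

set_option linter.dupNamespace false

namespace Summit.Schanuel.Schanuel.Theorems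

/-! ## Part D. Density: rational fibres over a conic -/

section Conic

variable (P : Polynomial ℂ)

/-- **Rational fibres over a conic: dense.**  `P` monic of degree `2` with a simple root;
`(A, B) ≠ (0, 0)`, `(A', B') ≠ (0, 0)`; `S` irreducible closed of dimension `≤ 2` containing every
point `(x₀, x₁, (A + x₁B)/(A' + x₁B'), e^{x₁})` of the graph off the poles.  Then `S` has Zariski-dense
exponential points. [cite: MantovaMasser2023, §1 Further remarks, p. 5 (the question, open in
general)] (new) -/
theorem unprojectedDense_conic_rationalFibre (A B A' B' : ℂ[X]) (hAB : A ≠ 0 ∨ B ≠ 0)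
    (hAB' : A' ≠ 0 ∨ B' ≠ 0) (hP : P.Monic) (h2 : P.natDegree = 2) {r : ℂ} (hr : P.IsRoot r)
    (hr1 : P.derivative.eval r ≠ 0) {S : Set (Fin 2 ⊕ Fin 2 → ℂ)} (hS : IsIrreducibleClosed ℂ S)
    (hdim : zariskiDim ℂ S ≤ (2 : ℕ))
    (hsub : ∀ x y : ℂ, y ^ 2 = P.eval x → A'.eval x + y * B'.eval x ≠ 0 →
      (Sum.elim ![x, y] ![(A.eval x + y * B.eval x) / (A'.eval x + y * B'.eval x), Complex.exp y] :
        Fin 2 ⊕ Fin 2 → ℂ) ∈ S) :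
    UnprojectedDense S := by
  classical
  obtain ⟨hPeval, hc0⟩ := conic_normalForm P hP h2 hr hr1
  set p₁ : ℂ := P.coeff 1 with hp₁
  set p₀ : ℂ := P.coeff 0 with hp₀
  have hN : A ^ 2 - P * B ^ 2 ≠ 0 := sq_sub_mul_sq_ne_zero P A B hr hr1 hAB
  have hN' : A' ^ 2 - P * B' ^ 2 ≠ 0 := sq_sub_mul_sq_ne_zero P A' B' hr hr1 hAB'
  obtain ⟨η, hηan, hη0, hηQ⟩ := exists_conic_branch p₁ (p₀ - p₁ ^ 2 / 4)
  obtain ⟨ψ₁, L₁, hψ₁an, hψ₁0, hf₁⟩ := exists_sheetFibre_normalForm hηan hηQ hPeval hN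
  obtain ⟨ψ₂, L₂, hψ₂an, hψ₂0, hf₂⟩ := exists_sheetFibre_normalForm hηan hηQ hPeval hN'
  set ψ : ℂ → ℂ := fun u => ψ₁ u / ψ₂ u with hψ
  have hψan : AnalyticAt ℂ ψ 0 := hψ₁an.div hψ₂an hψ₂0
  have hψ0 : ψ 0 ≠ 0 := div_ne_zero hψ₁0 hψ₂0
  set L : ℤ := L₁ - L₂ with hL
  have hψ₂ne : ∀ᶠ u in 𝓝 (0 : ℂ), ψ₂ u ≠ 0 := hψ₂an.continuousAt.eventually_ne hψ₂0
  -- the fibre value along the sheet: `f = ψ s^L`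
  have hf : ∀ᶠ s in 𝓝[≠] (0 : ℂ), A'.eval s⁻¹ + (s⁻¹ + p₁ / 2 + η s) * B'.eval s⁻¹ ≠ 0 ∧
      (A.eval s⁻¹ + (s⁻¹ + p₁ / 2 + η s) * B.eval s⁻¹) /
        (A'.eval s⁻¹ + (s⁻¹ + p₁ / 2 + η s) * B'.eval s⁻¹) = ψ s * s ^ L := by
    filter_upwards [hf₁, hf₂, eventually_nhdsWithin_of_eventually_nhds hψ₂ne, self_mem_nhdsWithin]
      with s h1 h2 hψ₂s hs0
    have hs0' : s ≠ 0 := hs0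
    refine ⟨by rw [h2]; exact mul_ne_zero hψ₂s (zpow_ne_zero _ hs0'), ?_⟩
    rw [h1, h2, hψ, hL, zpow_sub₀ hs0']
    simp only
    field_simp
  -- the labels: `e^{1/s_j} = ψ(s_j)s_j^L`
  obtain ⟨N₀, uu, s, ww, W, -, -, -, -, -, -, hs0, hs, hexp⟩ :=
    exists_poleFibre_expPoints (k := 1) le_rfl L hψan hψ0 (z := 2 * Real.pi * I) (by rw [pow_one])
  have hs' : Tendsto s atTop (𝓝[≠] (0 : ℂ)) :=
    tendsto_nhdsWithin_iff.2 ⟨hs, Eventually.of_forall fun j => hs0 j⟩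
  obtain ⟨M₀, hM₀⟩ := Filter.eventually_atTop.1
    (hs'.eventually ((eventually_nhdsWithin_of_eventually_nhds hηQ).and hf))
  set σ : ℕ → ℂ := fun m => s (M₀ + m) with hσ
  have hσ0 : ∀ m, σ m ≠ 0 := fun m => hs0 _
  have hσt : Tendsto σ atTop (𝓝 0) := hs.comp (tendsto_add_atTop_nat M₀ |>.congr fun m => by omega)
  have hσQ : ∀ m, σ m * η (σ m) ^ 2 + (2 + p₁ * σ m) * η (σ m) - (p₀ - p₁ ^ 2 / 4) * σ m = 0 :=
    fun m => (hM₀ (M₀ + m) (Nat.le_add_right _ _)).1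
  have hσd : ∀ m, A'.eval (σ m)⁻¹ + ((σ m)⁻¹ + p₁ / 2 + η (σ m)) * B'.eval (σ m)⁻¹ ≠ 0 :=
    fun m => (hM₀ (M₀ + m) (Nat.le_add_right _ _)).2.1
  have hσf : ∀ m, (A.eval (σ m)⁻¹ + ((σ m)⁻¹ + p₁ / 2 + η (σ m)) * B.eval (σ m)⁻¹) /
      (A'.eval (σ m)⁻¹ + ((σ m)⁻¹ + p₁ / 2 + η (σ m)) * B'.eval (σ m)⁻¹) = ψ (σ m) * σ m ^ L :=
    fun m => (hM₀ (M₀ + m) (Nat.le_add_right _ _)).2.2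
  have hexpσ : ∀ m, Complex.exp ((σ m)⁻¹) =
      (A.eval (σ m)⁻¹ + ((σ m)⁻¹ + p₁ / 2 + η (σ m)) * B.eval (σ m)⁻¹) /
        (A'.eval (σ m)⁻¹ + ((σ m)⁻¹ + p₁ / 2 + η (σ m)) * B'.eval (σ m)⁻¹) := by
    intro m
    have h := hexp (M₀ + m)
    rw [pow_one] at h
    rw [hσf]
    exact h
  -- the points
  set θ' : ℂ := Complex.exp (p₁ / 2) with hθ'
  have hθ'0 : θ' ≠ 0 := Complex.exp_ne_zero _
  set pt : ℕ → Fin 2 ⊕ Fin 2 → ℂ := fun m =>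
    Sum.elim ![(σ m)⁻¹, (σ m)⁻¹ + p₁ / 2 + η (σ m)]
      ![(A.eval (σ m)⁻¹ + ((σ m)⁻¹ + p₁ / 2 + η (σ m)) * B.eval (σ m)⁻¹) /
          (A'.eval (σ m)⁻¹ + ((σ m)⁻¹ + p₁ / 2 + η (σ m)) * B'.eval (σ m)⁻¹),
        Complex.exp ((σ m)⁻¹ + p₁ / 2 + η (σ m))] with hpt
  have hptS : ∀ m, pt m ∈ S := fun m =>
    hsub _ _ (conic_sheet_sq hPeval (hσ0 m) (hσQ m)) (hσd m)
  have hpΓ : ∀ m, pt m ∈ expGraph ℂ 2 := by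
    intro m
    rw [mem_expGraph_iff]
    intro i
    rw [Literature.ModelTheory.ExponentialFields.ExponentialRing.complex_exp_eq]
    fin_cases i
    · simp [hpt, hexpσ m]
    · simp [hpt]
  have hnorm : Tendsto (fun m => ‖pt m (Sum.inl 0)‖) atTop atTop := by
    have hσ' : Tendsto σ atTop (𝓝[≠] (0 : ℂ)) :=
      tendsto_nhdsWithin_iff.2 ⟨hσt, Eventually.of_forall fun m => hσ0 m⟩
    have h := (tendsto_norm_inv_nhdsNE_zero_atTop (α := ℂ)).comp hσ'
    refine h.congr fun m => ?_
    simp [hpt]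
  -- the relation `y₁ = w(σ)σ⁻¹^d`
  set d : ℕ := (-L).toNat with hd
  set w : ℂ → ℂ := fun u => ψ u * u ^ L.toNat * (θ' * Complex.exp (η u)) with hw
  have hwan : AnalyticAt ℂ w 0 :=
    (hψan.mul (analyticAt_id.pow _)).mul (analyticAt_const.mul hηan.cexp)
  have hzpow : ∀ u : ℂ, u ≠ 0 → u ^ L = u ^ L.toNat * u⁻¹ ^ d := by
    intro u hu
    conv_lhs => rw [← Int.toNat_sub_toNat_neg L]
    rw [zpow_sub₀ hu, zpow_natCast, zpow_natCast, hd, inv_pow, div_eq_mul_inv]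
  have hx : ∀ m, pt m (Sum.inl 0) = (fun _ : ℂ => (1 : ℂ)) (σ m) * (σ m)⁻¹ ^ 1 := by
    intro m; simp [hpt]
  have hy : ∀ m, pt m (Sum.inr 1) = w (σ m) * (σ m)⁻¹ ^ d := by
    intro m
    simp only [hpt, hw, Sum.elim_inr, Matrix.cons_val_one, Matrix.cons_val_fin_one]
    rw [Complex.exp_add, Complex.exp_add, hexpσ m, hσf m, hθ', hzpow _ (hσ0 m)]
    ring
  have htr : ∀ H : ℂ[X][X], H ≠ 0 →
      ¬ (∀ᶠ u in 𝓝[≠] (0 : ℂ), (H.map (Polynomial.evalRingHom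
        ((fun _ : ℂ => (1 : ℂ)) u * u⁻¹ ^ 1))).eval (w u * u⁻¹ ^ d) = 0) := by
    intro H hH0 hev
    refine conic_exp_relation_transcendental_rational hc0 hθ'0 hηan hη0 hηQ hPeval hN hN' H hH0 ?_
    filter_upwards [hev, hf, self_mem_nhdsWithin] with u hu hfu hu0
    have hu0' : u ≠ 0 := hu0
    have e1 : (fun _ : ℂ => (1 : ℂ)) u * u⁻¹ ^ 1 = u⁻¹ := by simp
    have e2 : w u * u⁻¹ ^ d =
        (A.eval u⁻¹ + (u⁻¹ + p₁ / 2 + η u) * B.eval u⁻¹) /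
          (A'.eval u⁻¹ + (u⁻¹ + p₁ / 2 + η u) * B'.eval u⁻¹) * (θ' * Complex.exp (η u)) := by
      rw [hfu.2, hzpow u hu0', hw]
      ring
    rw [e1, e2] at hu
    exact hu
  exact unprojectedDense_of_transcendental_relation_pole₂ hS hdim 0 1 hptS hpΓ hnorm
    analyticAt_const hwan 1 d hσ0 hσt hx hy htr

/-- **Rational fibres `R/Q` over a conic: dense.**  `P` monic of degree `2` with a simple root;
`R, Q ∈ ℂ[x₀, x₁]` each nonzero somewhere on the conic; `S` irreducible closed of dimension `≤ 2`
containing the graph of `R/Q` over the conic off the poles. [cite: MantovaMasser2023, §1 Further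
remarks, p. 5 (the question, open in general)] (new) -/
theorem unprojectedDense_conic_rationalFibreMv (R Q : MvPolynomial (Fin 2) ℂ)
    (hR : ∃ x : Fin 2 → ℂ, MvPolynomial.eval x
        (MvPolynomial.X 1 ^ 2 - Polynomial.aeval (MvPolynomial.X 0 : MvPolynomial (Fin 2) ℂ) P) = 0 ∧
      MvPolynomial.eval x R ≠ 0)
    (hQ : ∃ x : Fin 2 → ℂ, MvPolynomial.eval x
        (MvPolynomial.X 1 ^ 2 - Polynomial.aeval (MvPolynomial.X 0 : MvPolynomial (Fin 2) ℂ) P) = 0 ∧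
      MvPolynomial.eval x Q ≠ 0)
    (hP : P.Monic) (h2 : P.natDegree = 2) {r : ℂ} (hr : P.IsRoot r) (hr1 : P.derivative.eval r ≠ 0)
    {S : Set (Fin 2 ⊕ Fin 2 → ℂ)} (hS : IsIrreducibleClosed ℂ S) (hdim : zariskiDim ℂ S ≤ (2 : ℕ))
    (hsub : ∀ x y : ℂ, y ^ 2 = P.eval x → MvPolynomial.eval ![x, y] Q ≠ 0 →
      (Sum.elim ![x, y] ![MvPolynomial.eval ![x, y] R / MvPolynomial.eval ![x, y] Q, Complex.exp y] :
        Fin 2 ⊕ Fin 2 → ℂ) ∈ S) :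
    UnprojectedDense S := by
  obtain ⟨A, B, QR, hRAB⟩ := exists_hyperelliptic_reduction P R
  obtain ⟨A', B', QQ, hQAB⟩ := exists_hyperelliptic_reduction P Q
  have hAB : A ≠ 0 ∨ B ≠ 0 := reduction_ne_zero P A B R QR hRAB hR
  have hAB' : A' ≠ 0 ∨ B' ≠ 0 := reduction_ne_zero P A' B' Q QQ hQAB hQ
  have hevR : ∀ x y : ℂ, y ^ 2 = P.eval x →
      MvPolynomial.eval ![x, y] R = A.eval x + y * B.eval x := by
    intro x y hy
    rw [hRAB, map_add, map_mul, eval_sheetFibreMv, eval_superellipticMv]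
    simp [hy]
  have hevQ : ∀ x y : ℂ, y ^ 2 = P.eval x →
      MvPolynomial.eval ![x, y] Q = A'.eval x + y * B'.eval x := by
    intro x y hy
    rw [hQAB, map_add, map_mul, eval_sheetFibreMv, eval_superellipticMv]
    simp [hy]
  refine unprojectedDense_conic_rationalFibre P A B A' B' hAB hAB' hP h2 hr hr1 hS hdim ?_
  intro x y hy hd
  have hQ' : MvPolynomial.eval ![x, y] Q ≠ 0 := by rw [hevQ x y hy]; exact hd
  have h := hsub x y hy hQ'
  rw [hevR x y hy, hevQ x y hy] at h
  exact h

end Conic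

end Summit.Schanuel.Schanuel.Theorems

end
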